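import Literature.NumberTheory.LFunctions.Zhang2022.Section8Lemma84ContourBound
import HarnessLib

/-!
# Zhang (2022) §12: the difference of two logarithmic Riesz means on Landau's contour — the
# log-free twisted sum of the middle range (12.11), contour half

Topic `Literature/NumberTheory/LFunctions/Zhang2022` (Landau–Siegel audit tree; verdict-neutral).
Y. Zhang, *Discrete mean estimates and the Landau–Siegel zero*, arXiv:2211.02515v1 (2022)
[Zhang2022LandauSiegel] — **an unrefereed manuscript under adjudication; nothing here asserts or
denies its Theorems 1–2, and no claim about Landau–Siegel zeros is made.** Lane ZHANG-L (strike
seat zl-closer-3), leaf `Typed.Sec12C.Mid1225 c′` (§12 p.71, the sentence before (12.12): "the sum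
over `P″₁/T < dr ≤ P″₁` contributes `o(α)`", printed proof of the underlying (12.11): "similar to
that of ." [sic], tex L3549, GAP row G-L3t5-2). The tree reduces that leaf
(`Typed.Sec12C.mid1225_of_logfree`, zl-w12-p1) to ONE analytic input: a bound for the LOG-FREE
sharp twisted sum `Σ_{l<Y} χ(l)ξ₀ⱼ(l;d,r)l^{β₆−1}`, `Y = P″₂/dr`.

This file is the GENERIC contour half of that input. The tree's Lemma-8.4 engine
(`Lemma84.norm_sum_log_sub_main_le`) treats the logarithmic Riesz mean
`R(x) = Σ_{n≤x} f(n)log(x/n) = (2πi)⁻¹∫ e^{uL}Φ(u)u⁻²du` (absolutely convergent kernel `u⁻²`). A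
sharp sum has the conditionally convergent kernel `u⁻¹`; we avoid it by the exact identity
`Σ_{n≤x'} f(n) = (R(x) − R(x'))/h − (1/h)Σ_{x'<n≤x} f(n)log(x/n)`, `h = log(x/x')`, and bound the
DIFFERENCE `R(x) − R(x')` by running Landau's rectangle (`Lemma84.integral_line_decomp`,
`rect_big_eq_rect_small`, `norm_tails_le`, `norm_left_le`, `norm_horizontal_le` — all reused
verbatim) on the two kernels `e^{uL}u⁻²`, `e^{uL'}u⁻²` and estimating the small rectangle `∂R_s`
around the two poles DIRECTLY: there `e^{uL} − e^{uL'} = e^{uL'}(e^{uh} − 1)` has modulus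
`≤ 12αh·e^{αL/2}` (`|u| ≤ 6α`), so `∮_{∂R_s}` contributes `≤ 672·h·e^{αL/2}·sup_{∂R_s}|Φ|` — no residue
is evaluated and no main term appears (`norm_sum_log_diff_le`). For the manuscript's `Φ` the
boundary supremum is `O(αΠ̂²|L′(1,χ)|)` (the model comparison `Lemma84.norm_Phi_sub_model_le`), which
is what makes the log-free middle-range sum `O(𝓛⁻⁷Π̂²)` in the companion `Section12LogFreeMidSum`.

Theorems only; no new definitions, no facts; standard axioms.

## References

* Y. Zhang, arXiv:2211.02515v1 (2022), §12 Lemma 12.2 (12.11) p.70, §8 (8.9) and Lemma 8.4 (proof)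
  p.47. [cite: Zhang2022LandauSiegel, §12 (12.11) p.70; §8 Lemma 8.4 p.47]
* H. L. Montgomery, R. C. Vaughan, *Multiplicative Number Theory I*, CUP 2007, §5.1, §6.2.
  [cite: MontgomeryVaughan2007, §6.2]
-/

noncomputable section

open Complex Real Set MeasureTheory Filter Topology intervalIntegral

namespace Literature.NumberTheory.LFunctions.Zhang2022.Lemma84

open Literature.Analysis.Complex

section DiffContour

variable {D : ℕ} [NeZero D] (χ : DirichletCharacter ℂ D)
variable (U Φ : ℂ → ℂ) (f : ℕ → ℂ) (βμ βa βb : ℂ)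
variable {x x' ρ η α T' M_R M_l M_h M_c : ℝ}

/-- `‖(1/(2π) : ℂ)‖ = 1/(2π)` and `‖I/(2π)‖ = 1/(2π)`. [folklore] -/
private theorem norm_inv_two_pi' :
    ‖(1 / (2 * π) : ℂ)‖ = 1 / (2 * π) ∧ ‖(I / (2 * π) : ℂ)‖ = 1 / (2 * π) := by
  have h2π : ‖(2 * π : ℂ)‖ = 2 * π := by
    rw [norm_mul, Complex.norm_ofNat, Complex.norm_real, Real.norm_of_nonneg Real.pi_pos.le]
  constructor
  · rw [norm_div, norm_one, h2π]
  · rw [norm_div, Complex.norm_I, h2π]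

/-- **The two exponential kernels on the small rectangle**: for `Re u ≤ α/2`, `‖u‖ ≤ 6α`, `α ≤ 1/40`,
`0 ≤ L' ≤ L ≤ L' + 1`: `‖e^{uL} − e^{uL'}‖ ≤ 12α(L − L')e^{αL/2}` (`e^{uL} − e^{uL'} = e^{uL'}(e^{u(L−L')} − 1)`
and `‖e^z − 1‖ ≤ 2‖z‖` for `‖z‖ ≤ 1`). [folklore] -/
private theorem norm_cexp_sub_cexp_le {u : ℂ} {L L' : ℝ} (hα : 0 < α) (hα1 : α ≤ 1 / 40)
    (hre : u.re ≤ α / 2) (hu : ‖u‖ ≤ 6 * α) (hL' : 0 ≤ L') (hLL' : L' ≤ L) (hL1 : L - L' ≤ 1) :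
    ‖cexp (u * (L : ℂ)) - cexp (u * (L' : ℂ))‖ ≤ 12 * α * (L - L') * Real.exp (α * L / 2) := by
  have hsplit : cexp (u * (L : ℂ)) - cexp (u * (L' : ℂ)) =
      cexp (u * (L' : ℂ)) * (cexp (u * ((L - L' : ℝ) : ℂ)) - 1) := by
    rw [mul_sub, mul_one, ← Complex.exp_add]
    congr 1
    push_cast
    ring
  have h1 : ‖cexp (u * (L' : ℂ))‖ ≤ Real.exp (α * L / 2) := by
    rw [Complex.norm_exp]
    have : (u * (L' : ℂ)).re = u.re * L' := by simp [Complex.mul_re]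
    rw [this, Real.exp_le_exp]
    calc u.re * L' ≤ α / 2 * L' := mul_le_mul_of_nonneg_right hre hL'
      _ ≤ α / 2 * L := by gcongr
      _ = α * L / 2 := by ring
  have hz : ‖u * ((L - L' : ℝ) : ℂ)‖ ≤ 6 * α * (L - L') := by
    rw [norm_mul, Complex.norm_real, Real.norm_of_nonneg (by linarith)]
    exact mul_le_mul_of_nonneg_right hu (by linarith)
  have hz1 : ‖u * ((L - L' : ℝ) : ℂ)‖ ≤ 1 := by
    refine hz.trans ?_
    have : 6 * α * (L - L') ≤ 6 * α * 1 := by gcongr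
    linarith
  have h2 : ‖cexp (u * ((L - L' : ℝ) : ℂ)) - 1‖ ≤ 2 * (6 * α * (L - L')) :=
    (Complex.norm_exp_sub_one_le hz1).trans (by linarith)
  rw [hsplit, norm_mul]
  calc ‖cexp (u * (L' : ℂ))‖ * ‖cexp (u * ((L - L' : ℝ) : ℂ)) - 1‖
      ≤ Real.exp (α * L / 2) * (2 * (6 * α * (L - L'))) :=
        mul_le_mul h1 h2 (norm_nonneg _) (Real.exp_pos _).le
    _ = 12 * α * (L - L') * Real.exp (α * L / 2) := by ring

/-- **The small rectangle, two kernels**: with `G_L(u) = e^{uL}Φ(u)/u²`, if `G_{L'}` is continuous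
and `‖Φ‖ ≤ M_c` at every boundary point of `R_s = [−α/2, α/2] × [Im β_μ − 3α, Im β_μ + 3α]`
(`3α/2 ≤ Im β_μ ≤ 5α/2`, `0 < α ≤ 1/40`, `0 ≤ L' ≤ L ≤ L' + 1`), then
`‖∮_{∂R_s} G_L − ∮_{∂R_s} G_{L'}‖ ≤ 672(L − L')e^{αL/2}M_c` (perimeter `14α`, `|u| ≥ α/2` and `|u| ≤ 6α`
on `∂R_s`). [cite: Zhang2022LandauSiegel, §8 Lemma 8.4 (proof)] [cite: Conway1978, V.2.2] -/
theorem norm_rectSmall_diff_le {G G' : ℂ → ℂ} {L L' : ℝ} (hα : 0 < α) (hα1 : α ≤ 1 / 40)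
    (hL' : 0 ≤ L') (hLL' : L' ≤ L) (hL1 : L - L' ≤ 1) (hβμre : βμ.re = 0)
    (hβμ1 : 3 * α / 2 ≤ βμ.im) (hβμ2 : βμ.im ≤ 5 * α / 2) (hMc : 0 ≤ M_c)
    (hG : ∀ u, G u = cexp (u * (L : ℂ)) * Φ u / u ^ 2)
    (hG' : ∀ u, G' u = cexp (u * (L' : ℂ)) * Φ u / u ^ 2)
    (hΦc : ∀ u : ℂ, u.re ∈ Icc (-(α / 2)) (α / 2) → u.im ∈ Icc (βμ.im - 3 * α) (βμ.im + 3 * α) →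
      (|u.re| = α / 2 ∨ |u.im - βμ.im| = 3 * α) → ‖Φ u‖ ≤ M_c)
    (hGc : ∀ u : ℂ, u.re ∈ Icc (-(α / 2)) (α / 2) → u.im ∈ Icc (βμ.im - 3 * α) (βμ.im + 3 * α) →
      (|u.re| = α / 2 ∨ |u.im - βμ.im| = 3 * α) → ContinuousAt G u ∧ ContinuousAt G' u) :
    ‖rectBoundaryIntegral G (-(α / 2)) (α / 2) (βμ.im - 3 * α) (βμ.im + 3 * α) -
        rectBoundaryIntegral G' (-(α / 2)) (α / 2) (βμ.im - 3 * α) (βμ.im + 3 * α)‖ ≤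
      672 * (L - L') * Real.exp (α * L / 2) * M_c := by
  have hab : -(α / 2) < α / 2 := by linarith
  have hcd : βμ.im - 3 * α < βμ.im + 3 * α := by linarith
  -- the difference on the boundary
  set F : ℂ → ℂ := fun u => G u - G' u with hF
  set Mb : ℝ := 12 * α * (L - L') * Real.exp (α * L / 2) * M_c * (4 / α ^ 2) with hMb
  have hbd : ∀ u : ℂ, u.re ∈ Icc (-(α / 2)) (α / 2) →
      u.im ∈ Icc (βμ.im - 3 * α) (βμ.im + 3 * α) → (|u.re| = α / 2 ∨ |u.im - βμ.im| = 3 * α) →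
      ‖F u‖ ≤ Mb ∧ ContinuousAt F u ∧ ContinuousAt G' u := by
    intro u hre him hb
    obtain ⟨hnorm, hre2, hu0, -⟩ := bdry_facts hα hβμre hβμ1 hβμ2 hre hb
    obtain ⟨hGu, hG'u⟩ := hGc u hre him hb
    refine ⟨?_, hGu.sub hG'u, hG'u⟩
    have hu2 : u ^ 2 ≠ 0 := pow_ne_zero 2 hu0
    have hFu : F u = (cexp (u * (L : ℂ)) - cexp (u * (L' : ℂ))) * Φ u / u ^ 2 := by
      simp only [hF, hG u, hG' u]
      field_simp
    have hun : ‖u‖ ≤ 6 * α := by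
      calc ‖u‖ ≤ |u.re| + |u.im| := Complex.norm_le_abs_re_add_abs_im _
        _ ≤ α / 2 + (11 * α / 2) := by
            gcongr
            · exact abs_le.2 ⟨by linarith [hre.1], hre.2⟩
            · exact abs_le.2 ⟨by linarith [him.1], by linarith [him.2]⟩
        _ = 6 * α := by ring
    have hexp := norm_cexp_sub_cexp_le hα hα1 hre2 hun hL' hLL' hL1
    have husq : (α / 2) ^ 2 ≤ ‖u ^ 2‖ := by
      rw [norm_pow]; exact pow_le_pow_left₀ (by positivity) hnorm 2
    have hΦu := hΦc u hre him hb
    rw [hFu, norm_div, norm_mul]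
    calc ‖cexp (u * (L : ℂ)) - cexp (u * (L' : ℂ))‖ * ‖Φ u‖ / ‖u ^ 2‖
        ≤ (12 * α * (L - L') * Real.exp (α * L / 2)) * M_c / (α / 2) ^ 2 := by
          gcongr
      _ = Mb := by rw [hMb]; field_simp; ring
  -- boundary points of the four sides
  have re_im_pt : ∀ x₁ y₁ : ℝ, ((x₁ : ℂ) + y₁ * I).re = x₁ ∧ ((x₁ : ℂ) + y₁ * I).im = y₁ := by
    intro x₁ y₁; constructor <;> simp
  have hbot : ∀ x₁ ∈ Icc (-(α / 2)) (α / 2),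
      ((x₁ : ℂ) + (βμ.im - 3 * α : ℝ) * I).re ∈ Icc (-(α / 2)) (α / 2) ∧
      ((x₁ : ℂ) + (βμ.im - 3 * α : ℝ) * I).im ∈ Icc (βμ.im - 3 * α) (βμ.im + 3 * α) ∧
      (|((x₁ : ℂ) + (βμ.im - 3 * α : ℝ) * I).re| = α / 2 ∨
        |((x₁ : ℂ) + (βμ.im - 3 * α : ℝ) * I).im - βμ.im| = 3 * α) := by
    intro x₁ hx
    obtain ⟨h1, h2⟩ := re_im_pt x₁ (βμ.im - 3 * α)
    rw [h1, h2]
    refine ⟨hx, ⟨le_rfl, by linarith⟩, Or.inr ?_⟩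
    rw [show βμ.im - 3 * α - βμ.im = -(3 * α) by ring, abs_neg, abs_of_pos (by positivity)]
  have htop : ∀ x₁ ∈ Icc (-(α / 2)) (α / 2),
      ((x₁ : ℂ) + (βμ.im + 3 * α : ℝ) * I).re ∈ Icc (-(α / 2)) (α / 2) ∧
      ((x₁ : ℂ) + (βμ.im + 3 * α : ℝ) * I).im ∈ Icc (βμ.im - 3 * α) (βμ.im + 3 * α) ∧
      (|((x₁ : ℂ) + (βμ.im + 3 * α : ℝ) * I).re| = α / 2 ∨
        |((x₁ : ℂ) + (βμ.im + 3 * α : ℝ) * I).im - βμ.im| = 3 * α) := by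
    intro x₁ hx
    obtain ⟨h1, h2⟩ := re_im_pt x₁ (βμ.im + 3 * α)
    rw [h1, h2]
    refine ⟨hx, ⟨by linarith, le_rfl⟩, Or.inr ?_⟩
    rw [show βμ.im + 3 * α - βμ.im = 3 * α by ring, abs_of_pos (by positivity)]
  have hleft : ∀ y₁ ∈ Icc (βμ.im - 3 * α) (βμ.im + 3 * α),
      (((-(α / 2) : ℝ) : ℂ) + y₁ * I).re ∈ Icc (-(α / 2)) (α / 2) ∧
      (((-(α / 2) : ℝ) : ℂ) + y₁ * I).im ∈ Icc (βμ.im - 3 * α) (βμ.im + 3 * α) ∧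
      (|(((-(α / 2) : ℝ) : ℂ) + y₁ * I).re| = α / 2 ∨
        |(((-(α / 2) : ℝ) : ℂ) + y₁ * I).im - βμ.im| = 3 * α) := by
    intro y₁ hy
    obtain ⟨h1, h2⟩ := re_im_pt (-(α / 2)) y₁
    rw [h1, h2]
    refine ⟨⟨le_rfl, by linarith⟩, hy, Or.inl ?_⟩
    rw [abs_neg, abs_of_pos (by positivity)]
  have hright : ∀ y₁ ∈ Icc (βμ.im - 3 * α) (βμ.im + 3 * α),
      (((α / 2 : ℝ) : ℂ) + y₁ * I).re ∈ Icc (-(α / 2)) (α / 2) ∧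
      (((α / 2 : ℝ) : ℂ) + y₁ * I).im ∈ Icc (βμ.im - 3 * α) (βμ.im + 3 * α) ∧
      (|(((α / 2 : ℝ) : ℂ) + y₁ * I).re| = α / 2 ∨
        |(((α / 2 : ℝ) : ℂ) + y₁ * I).im - βμ.im| = 3 * α) := by
    intro y₁ hy
    obtain ⟨h1, h2⟩ := re_im_pt (α / 2) y₁
    rw [h1, h2]
    refine ⟨⟨by linarith, le_rfl⟩, hy, Or.inl ?_⟩
    rw [abs_of_pos (by positivity)]
  -- `∮ G = ∮ F + ∮ G'`
  have hsplit : rectBoundaryIntegral G (-(α / 2)) (α / 2) (βμ.im - 3 * α) (βμ.im + 3 * α) =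
      rectBoundaryIntegral F (-(α / 2)) (α / 2) (βμ.im - 3 * α) (βμ.im + 3 * α) +
        rectBoundaryIntegral G' (-(α / 2)) (α / 2) (βμ.im - 3 * α) (βμ.im + 3 * α) := by
    have h := rectBoundaryIntegral_add (F := F) (G := G') hab.le hcd.le
      (fun x hx => (hbd _ (hbot x hx).1 (hbot x hx).2.1 (hbot x hx).2.2).2.1)
      (fun x hx => (hbd _ (htop x hx).1 (htop x hx).2.1 (htop x hx).2.2).2.1)
      (fun y hy => (hbd _ (hleft y hy).1 (hleft y hy).2.1 (hleft y hy).2.2).2.1)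
      (fun y hy => (hbd _ (hright y hy).1 (hright y hy).2.1 (hright y hy).2.2).2.1)
      (fun x hx => (hbd _ (hbot x hx).1 (hbot x hx).2.1 (hbot x hx).2.2).2.2)
      (fun x hx => (hbd _ (htop x hx).1 (htop x hx).2.1 (htop x hx).2.2).2.2)
      (fun y hy => (hbd _ (hleft y hy).1 (hleft y hy).2.1 (hleft y hy).2.2).2.2)
      (fun y hy => (hbd _ (hright y hy).1 (hright y hy).2.1 (hright y hy).2.2).2.2)
    have he : (fun z => F z + G' z) = G := by
      funext z; simp only [hF, sub_add_cancel]
    rw [he] at h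
    exact h
  have hper := norm_rectBoundaryIntegral_le (F := F) hab.le hcd.le (M := Mb)
    (fun x hx => (hbd _ (hbot x hx).1 (hbot x hx).2.1 (hbot x hx).2.2).1)
    (fun x hx => (hbd _ (htop x hx).1 (htop x hx).2.1 (htop x hx).2.2).1)
    (fun y hy => (hbd _ (hleft y hy).1 (hleft y hy).2.1 (hleft y hy).2.2).1)
    (fun y hy => (hbd _ (hright y hy).1 (hright y hy).2.1 (hright y hy).2.2).1)
  rw [hsplit, add_sub_cancel_right]
  refine hper.trans (le_of_eq ?_)
  rw [hMb]
  field_simp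
  ring

set_option maxHeartbeats 800000 in
/-- **The difference of two logarithmic Riesz means on Landau's contour** (the setting of
`Lemma84.norm_sum_log_sub_main_le`, with the model comparison on the small rectangle replaced by a
plain supremum bound `‖Φ‖ ≤ M_c` on `∂R_s`): for `1 ≤ x' ≤ x` with `log x − log x' ≤ 1`,
`‖Σ_{n≤x} f(n)log(x/n) − Σ_{n≤x'} f(n)log(x'/n)‖ ≤ (2π)⁻¹(4e^{αL}M_R/T′ + 2e^{−ηL′}M_lπ/η
+ 4(α+η)e^{αL}M_h/T′² + 672(L − L′)e^{αL/2}M_c)` (`L = log x`, `L′ = log x′`): Perron at `Re u = 9`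
shifted to `Re u = α` and the rectangle `[−η, α] × [−T′, T′]` for EACH of the two kernels
`e^{uL}u⁻²`, `e^{uL′}u⁻²` (tails, left side, horizontal sides bounded separately), the residue
bookkeeping `rect_big_eq_rect_small` for each, and the small rectangle for the DIFFERENCE
(`norm_rectSmall_diff_le`) — no residue is computed. [cite: Zhang2022LandauSiegel, §8 (8.9) and Lemma 8.4 (proof); §12 (12.11) p.70]
[cite: MontgomeryVaughan2007, §6.2] -/
theorem norm_sum_log_diff_le (hχ1 : χ ≠ 1)
    (hUd : DifferentiableOn ℂ U {s : ℂ | 9 / 10 < s.re})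
    (hβμ : βμ.re = 0) (hβμ1 : 3 * α / 2 ≤ βμ.im) (hβμ2 : βμ.im ≤ 5 * α / 2)
    (hΦ : ∀ u, Φ u = U (1 - βμ + u) * χ.LFunction (1 - βμ + u + βa) *
      χ.LFunction (1 - βμ + u + βb) / χ.LFunction (1 - βμ + u))
    (hx' : 1 ≤ x') (hxx' : x' ≤ x) (hlog1 : Real.log x - Real.log x' ≤ 1)
    (hα : 0 < α) (hαη : α ≤ η) (hη : η ≤ 1 / 40) (hT : 1 ≤ T')
    (hρ1 : ρ < 1) (hρα : 1 - α / 2 < ρ) (hLρ : χ.LFunction ρ = 0)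
    (hL'ρ : deriv χ.LFunction ρ ≠ 0)
    (hzf : ∀ w : ℂ, 1 - 2 * η < w.re → |w.im| < T' + 1 → w ≠ ρ → χ.LFunction w ≠ 0)
    (hf : LSeriesSummable f 9) (hfΦ : ∀ t : ℝ, LSeries f ((9 : ℝ) + t * I) = Φ ((9 : ℝ) + t * I))
    (hMR0 : 0 ≤ M_R) (hPhiR : ∀ u : ℂ, α ≤ u.re → χ.LFunction (1 - βμ + u) ≠ 0 ∧ ‖Φ u‖ ≤ M_R)
    (hMl0 : 0 ≤ M_l) (hPhiL : ∀ t : ℝ, |t| ≤ T' → ‖Φ (((-η : ℝ) : ℂ) + t * I)‖ ≤ M_l)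
    (hMh0 : 0 ≤ M_h)
    (hPhiH : ∀ x₁ y₁ : ℝ, -η ≤ x₁ → x₁ ≤ α → |y₁| = T' → ‖Φ ((x₁ : ℂ) + y₁ * I)‖ ≤ M_h)
    (hMc0 : 0 ≤ M_c)
    (hPhiC : ∀ u : ℂ, u.re ∈ Icc (-(α / 2)) (α / 2) →
      u.im ∈ Icc (βμ.im - 3 * α) (βμ.im + 3 * α) → (|u.re| = α / 2 ∨ |u.im - βμ.im| = 3 * α) →
      ‖Φ u‖ ≤ M_c) :
    ‖(∑ n ∈ Finset.Ioc 0 ⌊x⌋₊, f n * (Real.log (x / n) : ℂ)) -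
        ∑ n ∈ Finset.Ioc 0 ⌊x'⌋₊, f n * (Real.log (x' / n) : ℂ)‖ ≤
      1 / (2 * π) * (4 * (Real.exp (α * Real.log x) * M_R / T') +
        2 * (Real.exp (-η * Real.log x') * M_l * (π / η)) +
        4 * ((α + η) * (Real.exp (α * Real.log x) * M_h / T' ^ 2)) +
        672 * (Real.log x - Real.log x') * Real.exp (α * Real.log x / 2) * M_c) := by
  have hx : 1 ≤ x := le_trans hx' hxx'
  have hx0 : 0 < x := by linarith
  have hx'0 : 0 < x' := by linarith
  have hLx : 0 ≤ Real.log x := Real.log_nonneg hx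
  have hLx' : 0 ≤ Real.log x' := Real.log_nonneg hx'
  have hLL : Real.log x' ≤ Real.log x := Real.log_le_log hx'0 hxx'
  have hη0 : 0 < η := lt_of_lt_of_le hα hαη
  have hα1 : α ≤ 1 / 40 := le_trans hαη hη
  have hβμim : 0 < βμ.im := by linarith
  have hβμim' : βμ.im ≤ 1 / 4 := by linarith
  have hβμα : βμ.im < 3 * α := by linarith
  -- the two integrands
  set E : ℂ → ℂ := fun u => cexp (u * (Real.log x : ℂ)) * Φ u / u ^ 2 with hE
  set E' : ℂ → ℂ := fun u => cexp (u * (Real.log x' : ℂ)) * Φ u / u ^ 2 with hE'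
  have hEu : ∀ u, E u = cexp (u * (Real.log x : ℂ)) * Φ u / u ^ 2 := fun u => rfl
  have hE'u : ∀ u, E' u = cexp (u * (Real.log x' : ℂ)) * Φ u / u ^ 2 := fun u => rfl
  -- differentiability of `Φ` to the right of `Re u = α`
  have hΦdiff : ∀ u : ℂ, α ≤ u.re → DifferentiableAt ℂ Φ u := fun u hu =>
    differentiableAt_Phi χ U Φ βμ βa βb hχ1 hUd hβμ hΦ (by linarith) (hPhiR u hu).1
  have hΦd : DifferentiableOn ℂ Φ (re ⁻¹' Icc α 9) := fun u hu =>
    (hΦdiff u hu.1).differentiableWithinAt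
  -- Perron at `Re u = 9`, shifted to `Re u = α`, for both points
  have hP := sum_log_eq_integral_shift (f := f) hx hα (by linarith : α ≤ (9 : ℝ)) hf hΦd hfΦ
    (M := M_R) (fun u h1 _ => (hPhiR u h1).2)
  have hP' := sum_log_eq_integral_shift (f := f) hx' hα (by linarith : α ≤ (9 : ℝ)) hf hΦd hfΦ
    (M := M_R) (fun u h1 _ => (hPhiR u h1).2)
  -- integrability on `Re u = α`
  have hcont : Continuous fun t : ℝ => Φ ((α : ℂ) + t * I) := by
    have hline : Continuous fun t : ℝ => (α : ℂ) + t * I := by fun_prop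
    exact continuous_iff_continuousAt.2 fun t =>
      ((hΦdiff _ (by simp)).continuousAt).comp hline.continuousAt
  have hint : Integrable fun t : ℝ => E ((α : ℂ) + t * I) :=
    integrable_line (L := Real.log x) hα hcont (fun t => (hPhiR _ (by simp)).2)
  have hint' : Integrable fun t : ℝ => E' ((α : ℂ) + t * I) :=
    integrable_line (L := Real.log x') hα hcont (fun t => (hPhiR _ (by simp)).2)
  -- rectangle decompositions
  have hdec := integral_line_decomp (Θ := E) (σ₀ := α) (σ₁ := η) (T := T') hint
  have hdec' := integral_line_decomp (Θ := E') (σ₀ := α) (σ₁ := η) (T := T') hint'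
  -- big rectangle = small rectangle, for both
  have hRR := rect_big_eq_rect_small χ U Φ E βμ βa βb (Real.log x : ℂ) ρ η α T' hχ1 hUd hβμ
    hβμim hβμim' hΦ hEu hαη hη hT hβμα hρ1 hρα hLρ hL'ρ hzf
  have hRR' := rect_big_eq_rect_small χ U Φ E' βμ βa βb (Real.log x' : ℂ) ρ η α T' hχ1 hUd hβμ
    hβμim hβμim' hΦ hE'u hαη hη hT hβμα hρ1 hρα hLρ hL'ρ hzf
  -- continuity of both integrands at the small rectangle's boundary
  have hGc : ∀ u : ℂ, u.re ∈ Icc (-(α / 2)) (α / 2) →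
      u.im ∈ Icc (βμ.im - 3 * α) (βμ.im + 3 * α) → (|u.re| = α / 2 ∨ |u.im - βμ.im| = 3 * α) →
      ContinuousAt E u ∧ ContinuousAt E' u := by
    intro u hre him hb
    obtain ⟨hnorm, -, hu0, -⟩ := bdry_facts hα hβμ hβμ1 hβμ2 hre hb
    have hLne : χ.LFunction (1 - βμ + u) ≠ 0 := by
      refine hzf _ ?_ ?_ ?_
      · simp only [add_re, sub_re, one_re, hβμ]; linarith [hre.1]
      · have : (1 - βμ + u).im = u.im - βμ.im := by simp; ring
        rw [this, abs_lt]; constructor <;> linarith [him.1, him.2]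
      · intro h
        have hure : u.re = ρ - 1 := by
          have := congrArg Complex.re h
          simp only [add_re, sub_re, one_re, hβμ, Complex.ofReal_re] at this
          linarith
        have huim : u.im = βμ.im := by
          have := congrArg Complex.im h
          simp only [add_im, sub_im, one_im, Complex.ofReal_im] at this
          linarith
        rcases hb with h' | h'
        · rw [hure] at h'
          rcases (abs_eq (by positivity : (0 : ℝ) ≤ α / 2)).1 h' with h'' | h'' <;> linarith
        · rw [huim, sub_self, abs_zero] at h'; linarith
    have hd := differentiableAt_Phi χ U Φ βμ βa βb hχ1 hUd hβμ hΦ (u := u) (by linarith [hre.1]) hLne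
    exact ⟨(differentiableAt_G Φ E (Real.log x : ℂ) hEu hd hu0).continuousAt,
      (differentiableAt_G Φ E' (Real.log x' : ℂ) hE'u hd hu0).continuousAt⟩
  have hsmall := norm_rectSmall_diff_le (Φ := Φ) (βμ := βμ) (M_c := M_c) (G := E) (G' := E')
    (L := Real.log x) (L' := Real.log x') hα hα1 hLx' hLL hlog1 hβμ hβμ1 hβμ2 hMc0 hEu hE'u
    hPhiC hGc
  -- the bounds for the pieces (both points)
  have htails := norm_tails_le (Φ := Φ) (L := Real.log x) hα hT hMR0
    (fun t _ => (hPhiR _ (by simp)).2)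
  have htails' := norm_tails_le (Φ := Φ) (L := Real.log x') hα hT hMR0
    (fun t _ => (hPhiR _ (by simp)).2)
  have hleft := norm_left_le (Φ := Φ) (L := Real.log x) (T := T') hη0 (by linarith) hMl0 hPhiL
  have hleft' := norm_left_le (Φ := Φ) (L := Real.log x') (T := T') hη0 (by linarith) hMl0 hPhiL
  have hB : ∀ (L₁ : ℝ), 0 ≤ L₁ → L₁ ≤ Real.log x → ∀ (Θ : ℂ → ℂ),
      (∀ u, Θ u = cexp (u * (L₁ : ℂ)) * Φ u / u ^ 2) →
      ∀ (y₁ : ℝ) (_ : |y₁| = T') (u : ℝ), -η ≤ u → u ≤ α →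
      ‖Θ ((u : ℂ) + (y₁ : ℂ) * I)‖ ≤ Real.exp (α * Real.log x) * M_h / T' ^ 2 := by
    intro L₁ hL₁ hL₁x Θ hΘ y₁ hy₁ u hu1 hu2
    have hsq : u ^ 2 + y₁ ^ 2 ≠ 0 := by
      have : y₁ ^ 2 = T' ^ 2 := by rw [← sq_abs, hy₁]
      nlinarith
    have h := norm_G_line_le (L := L₁) (σ := u) (t := y₁) (hPhiH u y₁ hu1 hu2 hy₁) hsq
    rw [hΘ]
    refine h.trans ?_
    have hT2 : T' ^ 2 ≤ u ^ 2 + y₁ ^ 2 := by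
      have : y₁ ^ 2 = T' ^ 2 := by rw [← sq_abs, hy₁]
      nlinarith
    have hnum : Real.exp (u * L₁) * M_h ≤ Real.exp (α * Real.log x) * M_h := by
      refine mul_le_mul_of_nonneg_right (Real.exp_le_exp.2 ?_) hMh0
      calc u * L₁ ≤ α * L₁ := mul_le_mul_of_nonneg_right hu2 hL₁
        _ ≤ α * Real.log x := mul_le_mul_of_nonneg_left hL₁x hα.le
    exact div_le_div₀ (by positivity) hnum (by positivity) hT2
  have hbot := norm_horizontal_le (Θ := E) (σ₀ := α) (σ₁ := η) (T' := -T')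
    (B := Real.exp (α * Real.log x) * M_h / T' ^ 2) (by linarith)
    (hB (Real.log x) hLx le_rfl E hEu (-T') (by rw [abs_neg, abs_of_pos (by linarith)]))
  have htop := norm_horizontal_le (Θ := E) (σ₀ := α) (σ₁ := η) (T' := T')
    (B := Real.exp (α * Real.log x) * M_h / T' ^ 2) (by linarith)
    (hB (Real.log x) hLx le_rfl E hEu T' (abs_of_pos (by linarith)))
  have hbot' := norm_horizontal_le (Θ := E') (σ₀ := α) (σ₁ := η) (T' := -T')
    (B := Real.exp (α * Real.log x) * M_h / T' ^ 2) (by linarith)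
    (hB (Real.log x') hLx' hLL E' hE'u (-T') (by rw [abs_neg, abs_of_pos (by linarith)]))
  have htop' := norm_horizontal_le (Θ := E') (σ₀ := α) (σ₁ := η) (T' := T')
    (B := Real.exp (α * Real.log x) * M_h / T' ^ 2) (by linarith)
    (hB (Real.log x') hLx' hLL E' hE'u T' (abs_of_pos (by linarith)))
  -- names for the pieces
  set T₁ : ℂ := ∫ t in Iic (-T'), E ((α : ℂ) + t * I) with hT₁
  set T₂ : ℂ := ∫ t in Ioi T', E ((α : ℂ) + t * I) with hT₂
  set Lf : ℂ := ∫ t in (-T')..T', E (((-η : ℝ) : ℂ) + t * I) with hLf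
  set Bo : ℂ := ∫ u in (-η)..α, E (u + ((-T' : ℝ) : ℂ) * I) with hBo
  set Tp : ℂ := ∫ u in (-η)..α, E (u + (T' : ℂ) * I) with hTp
  set Rs : ℂ := rectBoundaryIntegral E (-(α / 2)) (α / 2) (βμ.im - 3 * α) (βμ.im + 3 * α) with hRs
  set T₁' : ℂ := ∫ t in Iic (-T'), E' ((α : ℂ) + t * I) with hT₁'
  set T₂' : ℂ := ∫ t in Ioi T', E' ((α : ℂ) + t * I) with hT₂'
  set Lf' : ℂ := ∫ t in (-T')..T', E' (((-η : ℝ) : ℂ) + t * I) with hLf'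
  set Bo' : ℂ := ∫ u in (-η)..α, E' (u + ((-T' : ℝ) : ℂ) * I) with hBo'
  set Tp' : ℂ := ∫ u in (-η)..α, E' (u + (T' : ℂ) * I) with hTp'
  set Rs' : ℂ := rectBoundaryIntegral E' (-(α / 2)) (α / 2) (βμ.im - 3 * α) (βμ.im + 3 * α)
    with hRs'
  have hS : (∑ n ∈ Finset.Ioc 0 ⌊x⌋₊, f n * (Real.log (x / n) : ℂ)) =
      (1 / (2 * π) : ℂ) * (T₁ + T₂ + Lf + I * Bo - I * Tp - I * Rs) := by
    rw [hP]
    congr 1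
    rw [← hRR, ← hdec]
  have hS' : (∑ n ∈ Finset.Ioc 0 ⌊x'⌋₊, f n * (Real.log (x' / n) : ℂ)) =
      (1 / (2 * π) : ℂ) * (T₁' + T₂' + Lf' + I * Bo' - I * Tp' - I * Rs') := by
    rw [hP']
    congr 1
    rw [← hRR', ← hdec']
  have key : (∑ n ∈ Finset.Ioc 0 ⌊x⌋₊, f n * (Real.log (x / n) : ℂ)) -
      (∑ n ∈ Finset.Ioc 0 ⌊x'⌋₊, f n * (Real.log (x' / n) : ℂ)) =
      (1 / (2 * π) : ℂ) * ((T₁ + T₂ + Lf + I * Bo - I * Tp) - (T₁' + T₂' + Lf' + I * Bo' - I * Tp'))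
        - (I / (2 * π)) * (Rs - Rs') := by
    rw [hS, hS']
    have hπ : (π : ℂ) ≠ 0 := by exact_mod_cast Real.pi_ne_zero
    field_simp
    ring
  obtain ⟨n1, n2⟩ := norm_inv_two_pi'
  have hπ0 : 0 < 1 / (2 * π) := by positivity
  rw [key]
  -- norms of the pieces
  have hexpL : Real.exp (α * Real.log x') ≤ Real.exp (α * Real.log x) :=
    Real.exp_le_exp.2 (mul_le_mul_of_nonneg_left hLL hα.le)
  have hexpη : Real.exp (-η * Real.log x) ≤ Real.exp (-η * Real.log x') :=
    Real.exp_le_exp.2 (by nlinarith)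
  have hnT : ‖T₂‖ + ‖T₁‖ ≤ 2 * (Real.exp (α * Real.log x) * M_R / T') := htails
  have hnT' : ‖T₂'‖ + ‖T₁'‖ ≤ 2 * (Real.exp (α * Real.log x) * M_R / T') := by
    refine htails'.trans ?_
    gcongr
  have hnL : ‖Lf‖ ≤ Real.exp (-η * Real.log x') * M_l * (π / η) := by
    refine hleft.trans ?_
    gcongr
  have hnL' : ‖Lf'‖ ≤ Real.exp (-η * Real.log x') * M_l * (π / η) := hleft'
  have hnBo : ‖Bo‖ ≤ (α + η) * (Real.exp (α * Real.log x) * M_h / T' ^ 2) := hbot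
  have hnTp : ‖Tp‖ ≤ (α + η) * (Real.exp (α * Real.log x) * M_h / T' ^ 2) := htop
  have hnBo' : ‖Bo'‖ ≤ (α + η) * (Real.exp (α * Real.log x) * M_h / T' ^ 2) := hbot'
  have hnTp' : ‖Tp'‖ ≤ (α + η) * (Real.exp (α * Real.log x) * M_h / T' ^ 2) := htop'
  have hnRs : ‖Rs - Rs'‖ ≤
      672 * (Real.log x - Real.log x') * Real.exp (α * Real.log x / 2) * M_c := hsmall
  have hfive : ∀ a b c d e : ℂ, ‖a + b + c + I * d - I * e‖ ≤ ‖a‖ + ‖b‖ + ‖c‖ + ‖d‖ + ‖e‖ := by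
    intro a b c d e
    calc ‖a + b + c + I * d - I * e‖
        ≤ ‖a + b + c + I * d‖ + ‖I * e‖ := norm_sub_le _ _
      _ ≤ (‖a + b + c‖ + ‖I * d‖) + ‖I * e‖ := by gcongr; exact norm_add_le _ _
      _ ≤ ((‖a + b‖ + ‖c‖) + ‖I * d‖) + ‖I * e‖ := by gcongr; exact norm_add_le _ _
      _ ≤ (((‖a‖ + ‖b‖) + ‖c‖) + ‖I * d‖) + ‖I * e‖ := by gcongr; exact norm_add_le _ _
      _ = ‖a‖ + ‖b‖ + ‖c‖ + ‖d‖ + ‖e‖ := by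
          rw [norm_mul, norm_mul, Complex.norm_I, one_mul, one_mul]
  calc ‖(1 / (2 * π) : ℂ) * ((T₁ + T₂ + Lf + I * Bo - I * Tp) - (T₁' + T₂' + Lf' + I * Bo' - I * Tp'))
          - (I / (2 * π)) * (Rs - Rs')‖
      ≤ ‖(1 / (2 * π) : ℂ) * ((T₁ + T₂ + Lf + I * Bo - I * Tp) -
            (T₁' + T₂' + Lf' + I * Bo' - I * Tp'))‖ + ‖(I / (2 * π)) * (Rs - Rs')‖ :=
        norm_sub_le _ _
    _ = 1 / (2 * π) * ‖(T₁ + T₂ + Lf + I * Bo - I * Tp) - (T₁' + T₂' + Lf' + I * Bo' - I * Tp')‖ +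
          1 / (2 * π) * ‖Rs - Rs'‖ := by rw [norm_mul, norm_mul, n1, n2]
    _ ≤ 1 / (2 * π) * ((‖T₁‖ + ‖T₂‖ + ‖Lf‖ + ‖Bo‖ + ‖Tp‖) + (‖T₁'‖ + ‖T₂'‖ + ‖Lf'‖ + ‖Bo'‖ + ‖Tp'‖))
          + 1 / (2 * π) * ‖Rs - Rs'‖ := by
        gcongr
        exact (norm_sub_le _ _).trans (add_le_add (hfive _ _ _ _ _) (hfive _ _ _ _ _))
    _ ≤ 1 / (2 * π) * (4 * (Real.exp (α * Real.log x) * M_R / T') +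
          2 * (Real.exp (-η * Real.log x') * M_l * (π / η)) +
          4 * ((α + η) * (Real.exp (α * Real.log x) * M_h / T' ^ 2))) +
          1 / (2 * π) * (672 * (Real.log x - Real.log x') * Real.exp (α * Real.log x / 2) * M_c) := by
        have hsum : (‖T₁‖ + ‖T₂‖ + ‖Lf‖ + ‖Bo‖ + ‖Tp‖) + (‖T₁'‖ + ‖T₂'‖ + ‖Lf'‖ + ‖Bo'‖ + ‖Tp'‖) ≤
            4 * (Real.exp (α * Real.log x) * M_R / T') +
              2 * (Real.exp (-η * Real.log x') * M_l * (π / η)) +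
              4 * ((α + η) * (Real.exp (α * Real.log x) * M_h / T' ^ 2)) := by linarith
        exact add_le_add (mul_le_mul_of_nonneg_left hsum hπ0.le)
          (mul_le_mul_of_nonneg_left hnRs hπ0.le)
    _ = _ := by ring

end DiffContour

end Literature.NumberTheory.LFunctions.Zhang2022.Lemma84
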